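import Summits.HodgeConjecture.HodgeConjecture.Theorems.R90S6SatakeCoeffEtaOnePartner   -- ★ TE3: `laurentEvalAt_bcLine_eq_laurentEvalAt_normFibre_two` (unsigned twin); brings ★ B3 `prod_zpow_param_two`, ★ `laurentEvalAt_single`
import Mathlib.Algebra.Ring.NegOnePow
import HarnessLib

/-!
# R90 · S6 «Ch. 14.1–14.5 stable trace formula» — card TB2c (rows E1.4.4.2.4-prep ∕ E1.4.4.3.1): THE PARITY LAYER ON THE SATAKE SIDE — SIGNED NORM-FIBRE SUMS
# `ev_{(z,−1,z⁻¹)}(P) = Σ_k (Σ_{μ₀−μ₂=k} (−1)^{μ₁} P_μ) z^k`, `ev_{(−z,1,−z⁻¹)}(P) = Σ_k (Σ_{μ₀−μ₂=k} (−1)^{μ₀+μ₂} P_μ) z^k`, and the even∕odd split of a norm fibre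
# (`Theorems/R90S6SatakeCoeffSignedFibre.lean`)

Cell `hodgecm-mathlib`, crux H413 (`stmt-HodgeConjecture-24833`), route of record `HCCMUnconditional`; programme R90-TF (brief `director/R90-BRIEF.v2.md`
1f40d54518340a35), section S6 (base `R90-C14`, dealer R90-C14-plan (g2)), seat R90-C14-p04 (g2); CARD TB2c dealt BY NAME 2026-09-05T01:43:05Z (R90 bus).  Lane
`--kind proof --supports stmt-HodgeConjecture-24833 --as helper`; THEOREMS ONLY (no definition, no instance, no notation, no named fact, no kit, no `sorry`); PURE LAURENT
ALGEBRA over ★ `laurentEvalAt` (no Hecke carrier outside this docstring).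

## WHY (dealer's dictionary, recorded): at an ε-diagonal `δ = t_μ·δ₀` the ε-classes inside the stable ε-class are indexed by the coset `μ + (1−ε)X_*`,
`(1−ε)ν = (ν₀+ν₂, 2ν₁, ν₀+ν₂)` for `ε : ν ↦ (−ν₂,−ν₁,−ν₀)`, i.e. by `{μ′ : μ′₀ − μ′₂ = μ₀ − μ₂, μ′₁ ≡ μ₁ (2)}`: the STABLE twisted side sums the whole norm fibre
`{μ₀−μ₂ = k}` of the `GL₃` Satake polynomial `P = 𝒮^{GL}_{wt} φ` (★ TB3 `coeff_satakeTransform_bcGraphPartner`, ★ TE3 `coeff_satakeTransform_etaOneGraphPartner`), while the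
`κ̃`-weighted side (`κ̃ = μ_w ∘ det₀`, Rogawski §4.10 p. 57; unramified `μ_w(ϖ) = −1`) is the `μ₁`-PARITY-SIGNED fibre sum.  On parameters: the sign `(−1)^{μ₁}` is the evaluation at
`(z, −1, z⁻¹)`, the sign `(−1)^{μ₀+μ₂}` the evaluation at `(−z, 1, −z⁻¹)`, and the two differ by the central-character twist `(−1)^{|μ|}` (`μ_w ∘ det` on `t_μ`).  This file supplies
the coefficient identities either sign convention of row E1.4.4.3.1 will consume; the print pages for `κ̃`, `Δ̃` are in ★ L2-sgn `R90S6TwistedShellSign`'s docstring.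

## WHAT IS PROVED (`P ∈ ℂ[ℤ³]` arbitrary; `ℓ′_k = (k, −k)` the `U(1,1)` line, spelled `fun i : Fin 2 => k * (1 − 2i)` as ★ B3∕TE3; signs as Mathlib `Int.negOnePow` cast into `ℂ`)
* (SF.1) **`laurentEvalAt_signedLine_eq_laurentEvalAt_signedNormFibre`**: `ev_{(z,−1,z⁻¹)}(P) = ev_{(z,1)}(Σ_{μ ∈ supp P} x^{ℓ′_{μ₀−μ₂}} · (−1)^{μ₁} P_μ)`.
* (SF.2) **`laurentEvalAt_negLine_eq_laurentEvalAt_signedNormFibre`**: `ev_{(−z,1,−z⁻¹)}(P) = ev_{(z,1)}(Σ_{μ ∈ supp P} x^{ℓ′_{μ₀−μ₂}} · (−1)^{μ₀+μ₂} P_μ)`.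
* (SF.3) **`negOnePow_add_eq_negOnePow_mul_negOnePow_sum`**: `(−1)^{μ₀+μ₂} = (−1)^{μ₁} · (−1)^{μ₀+μ₁+μ₂}` (the two signs differ by the central twist `(−1)^{|μ|}`).
* (SF.4) **`sum_fibre_negOnePow_mul_eq_sum_even_sub_sum_odd`**: `Σ_{μ ∈ supp P, μ₀−μ₂ = k} (−1)^{μ₁} P_μ = Σ_{…, μ₁ even} P_μ − Σ_{…, μ₁ odd} P_μ` (the unsigned split
  `Σ_{fibre} = Σ_{even} + Σ_{odd}` is Mathlib `Finset.sum_filter_add_sum_filter_not` verbatim — cited, not restated).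
* (SF.5) HEAD **`coeff_signedNormFibre`**: the coefficient of the signed transport at `ℓ′_k` is the SIGNED NORM-FIBRE SUM,
  `(Σ_{μ ∈ supp P} x^{ℓ′_{μ₀−μ₂}} · (−1)^{μ₁} P_μ)_{ℓ′_k} = Σ_{μ ∈ supp P, μ₀−μ₂ = k} (−1)^{μ₁} P_μ` (the extraction step of ★ TB3∕TE3, signed).
Kill-check (the `T₁` monomials, weights stripped): `P = x^{(1,0,0)} + x^{(0,1,0)} + x^{(0,0,1)}` — fibre `k = 0` is `{(0,1,0)}`: unsigned `1`, signed `−1`; fibres `k = ±1` one term each with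
sign `+` — matches `ev_{(z,−1,z⁻¹)} = z − 1 + z⁻¹`.
HONEST LABEL: Laurent-coefficient algebra; proves no printed statement and no orbital-integral identity, discharges no citation; count-neutral helper until rows E1.4.4.2.4 ∕
E1.4.4.3.1 consume it.  HC_CM is proved only modulo the 7 printed citations (2 remaining named inputs: hLiu418 = stmt-HodgeConjecture-24832, h413 = stmt-HodgeConjecture-24833)
until rung 0 closes; REL ≠ ★ ≠ BUILT.

## Tree search (dedup)
`rg "SatakeCoeffSignedFibre|signedNormFibre|laurentEvalAt_signedLine|laurentEvalAt_negLine|sum_fibre_negOnePow|negOnePow_add_eq_negOnePow_mul_negOnePow_sum|coeff_signedNormFibre"` over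
`lean/` — no hit (2026-09-05T01:44Z); REUSED ★: B3 `prod_zpow_param_two`, `laurentEvalAt_single`, Mathlib `Int.cast_negOnePow`, `Int.negOnePow_add`, `Int.negOnePow_even ∕ _odd`,
`Finset.sum_filter_add_sum_filter_not`, `AddMonoidAlgebra.sum_coeff_single`.

## References
* [Rogawski1990] J. D. Rogawski, *Automorphic Representations of Unitary Groups in Three Variables*, Ann. of Math. Stud. 123 (1990): §3.11 p. 34, §4.10 (4.10.1) p. 56, p. 57
  (`κ(ν) = ω_{E∕F}(det t_ν) = μ(det₀ t_ν)⁻¹`, `Δ̃`), Prop. 4.10.2 pp. 58–59 (`δ = d(x,y,z′) ↦ γ = d(x∕z̄′, y∕ȳ, z′∕x̄)`).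
* [CartierCorvallis1979] P. Cartier, *Representations of 𝔭-adic groups: a survey*, PSPM 33.1 (1979): §IV (4.2)–(4.4).
* [Kottwitz1986BaseChangeUnits] R. E. Kottwitz, *Base change for unit elements of Hecke algebras*, Compositio Math. 60 (1986): §1 pp. 239–243.
-/

set_option autoImplicit false
-- the mandated namespace repeats the single-problem summit's segment (`HodgeConjecture.HodgeConjecture`)
set_option linter.dupNamespace false

noncomputable section

open scoped Matrix
open Literature.NumberTheory.Automorphic

namespace Summit.HodgeConjecture.HodgeConjecture.R90.S6

/-! ## §1 The two signed base-change lines -/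

section SignedLines

/-- **(SF.1) `ev_{(z,−1,z⁻¹)}(P) = ev_{(z,1)}(Σ_{μ ∈ supp P} x^{ℓ′_{μ₀−μ₂}}·(−1)^{μ₁} P_μ)`** for every `P ∈ ℂ[ℤ³]`: the parameter `(z, −1, z⁻¹)` reads `x^μ ↦ (−1)^{μ₁} z^{μ₀−μ₂}`, so the
restriction to this line is the `μ₁`-PARITY-SIGNED norm-fibre sum pushed onto the `U(1,1)` line `ℓ′_k = (k,−k)` (★ TE3 `laurentEvalAt_bcLine_eq_laurentEvalAt_normFibre_two` is the
unsigned twin at `(z, 1, z⁻¹)`). [cite: Rogawski1990, §4.10 p. 57, Prop. 4.10.2 pp. 58–59] [cite: CartierCorvallis1979, §IV (4.2)] -/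
theorem laurentEvalAt_signedLine_eq_laurentEvalAt_signedNormFibre (P : AddMonoidAlgebra ℂ (Fin 3 → ℤ)) (z : ℂˣ) :
    laurentEvalAt ![z, -1, z⁻¹] P =
      laurentEvalAt ![z, 1] (∑ μ ∈ P.coeff.support,
        AddMonoidAlgebra.single (fun i : Fin 2 => (μ 0 - μ 2) * (1 - 2 * ((i : ℕ) : ℤ))) (((((μ 1).negOnePow : ℤˣ) : ℤ) : ℂ) * P.coeff μ)) := by
  classical
  conv_lhs => rw [← AddMonoidAlgebra.sum_coeff_single P, map_finsuppSum, Finsupp.sum]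
  rw [map_sum]
  refine Finset.sum_congr rfl fun μ _ => ?_
  rw [laurentEvalAt_single, laurentEvalAt_single, prod_zpow_param_two, Fin.prod_univ_three, Int.cast_negOnePow]
  simp only [Fin.isValue, Fin.val_zero, Nat.cast_zero, mul_zero, sub_zero, mul_one, Matrix.cons_val_zero, Matrix.cons_val_one, Matrix.cons_val_two,
    Matrix.tail_cons, Matrix.head_cons, Units.val_neg, Units.val_one, Units.val_inv_eq_inv_val, inv_zpow', zpow_sub₀ (Units.ne_zero z), div_eq_mul_inv,
    zpow_neg]
  ring

/-- **(SF.2) `ev_{(−z,1,−z⁻¹)}(P) = ev_{(z,1)}(Σ_{μ ∈ supp P} x^{ℓ′_{μ₀−μ₂}}·(−1)^{μ₀+μ₂} P_μ)`** for every `P ∈ ℂ[ℤ³]`: the parameter `(−z, 1, −z⁻¹)` reads `x^μ ↦ (−1)^{μ₀+μ₂} z^{μ₀−μ₂}`.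
[cite: Rogawski1990, §4.10 p. 57, Prop. 4.10.2 pp. 58–59] [cite: CartierCorvallis1979, §IV (4.2)] -/
theorem laurentEvalAt_negLine_eq_laurentEvalAt_signedNormFibre (P : AddMonoidAlgebra ℂ (Fin 3 → ℤ)) (z : ℂˣ) :
    laurentEvalAt ![-z, 1, -z⁻¹] P =
      laurentEvalAt ![z, 1] (∑ μ ∈ P.coeff.support,
        AddMonoidAlgebra.single (fun i : Fin 2 => (μ 0 - μ 2) * (1 - 2 * ((i : ℕ) : ℤ))) (((((μ 0 + μ 2).negOnePow : ℤˣ) : ℤ) : ℂ) * P.coeff μ)) := by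
  classical
  conv_lhs => rw [← AddMonoidAlgebra.sum_coeff_single P, map_finsuppSum, Finsupp.sum]
  rw [map_sum]
  refine Finset.sum_congr rfl fun μ _ => ?_
  rw [laurentEvalAt_single, laurentEvalAt_single, prod_zpow_param_two, Fin.prod_univ_three, Int.cast_negOnePow]
  have hneg : ((-z : ℂˣ) : ℂ) = (-1 : ℂ) * (z : ℂ) := by rw [Units.val_neg, neg_one_mul]
  have hnegi : ((-z⁻¹ : ℂˣ) : ℂ) = (-1 : ℂ) * ((z : ℂ))⁻¹ := by rw [Units.val_neg, Units.val_inv_eq_inv_val, neg_one_mul]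
  simp only [Fin.isValue, Fin.val_zero, Nat.cast_zero, mul_zero, sub_zero, mul_one, Matrix.cons_val_zero, Matrix.cons_val_one, Matrix.cons_val_two,
    Matrix.tail_cons, Matrix.head_cons, Units.val_one, one_zpow, hneg, hnegi, mul_zpow, inv_zpow', zpow_sub₀ (Units.ne_zero z), div_eq_mul_inv,
    zpow_neg, zpow_add₀ (show (-1 : ℂ) ≠ 0 from neg_ne_zero.2 one_ne_zero)]
  ring

/-- **(SF.3) the two signs differ by the central twist**: `(−1)^{μ₀+μ₂} = (−1)^{μ₁} · (−1)^{μ₀+μ₁+μ₂}` (`μ₀ + μ₂` and `μ₁ + |μ|` have the same parity).  Dictionary: `(−1)^{|μ|}` is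
`μ_w(det t_μ)` for the unramified `μ_w` with `μ_w(ϖ) = −1`, so the `(−z,1,−z⁻¹)`-line is the `(z,−1,z⁻¹)`-line twisted by `μ_w ∘ det`. [cite: Rogawski1990, §4.10 p. 57] -/
theorem negOnePow_add_eq_negOnePow_mul_negOnePow_sum (μ : Fin 3 → ℤ) :
    (μ 0 + μ 2).negOnePow = (μ 1).negOnePow * (μ 0 + μ 1 + μ 2).negOnePow := by
  rw [← Int.negOnePow_add, show μ 1 + (μ 0 + μ 1 + μ 2) = 2 * μ 1 + (μ 0 + μ 2) by ring, Int.negOnePow_add (2 * μ 1) (μ 0 + μ 2),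
    Int.negOnePow_two_mul, one_mul]

end SignedLines

/-! ## §2 The signed norm fibre: even part minus odd part, and the coefficient extraction -/

section Fibre

/-- **(SF.4) `Σ_{μ ∈ supp P, μ₀−μ₂ = k} (−1)^{μ₁} P_μ = Σ_{…, μ₁ even} P_μ − Σ_{…, μ₁ odd} P_μ`** — the signed norm-fibre sum is the EVEN part minus the ODD part of the fibre (the
unsigned fibre sum is their SUM, Mathlib `Finset.sum_filter_add_sum_filter_not`); the two ε-conjugacy families of the dealer's dictionary (`μ₁ mod 2`).
[cite: Rogawski1990, §3.11 p. 34, §4.10 (4.10.1) p. 56] [cite: Kottwitz1986BaseChangeUnits, §1 pp. 239–243] -/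
theorem sum_fibre_negOnePow_mul_eq_sum_even_sub_sum_odd (P : AddMonoidAlgebra ℂ (Fin 3 → ℤ)) (k : ℤ) :
    ∑ μ ∈ P.coeff.support with μ 0 - μ 2 = k, (((μ 1).negOnePow : ℤˣ) : ℤ) * P.coeff μ =
      (∑ μ ∈ {μ ∈ P.coeff.support | μ 0 - μ 2 = k} with Even (μ 1), P.coeff μ) -
        ∑ μ ∈ {μ ∈ P.coeff.support | μ 0 - μ 2 = k} with ¬ Even (μ 1), P.coeff μ := by
  classical
  rw [← Finset.sum_filter_add_sum_filter_not ({μ ∈ P.coeff.support | μ 0 - μ 2 = k}) (fun μ : Fin 3 → ℤ => Even (μ 1)), sub_eq_add_neg,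
    ← Finset.sum_neg_distrib]
  congr 1
  · refine Finset.sum_congr rfl fun μ hμ => ?_
    rw [(Finset.mem_filter.1 hμ).2 |> Int.negOnePow_even _, Units.val_one, Int.cast_one, one_mul]
  · refine Finset.sum_congr rfl fun μ hμ => ?_
    rw [Int.negOnePow_odd _ (Int.not_even_iff_odd.1 (Finset.mem_filter.1 hμ).2), Units.val_neg, Units.val_one, Int.cast_neg, Int.cast_one,
      neg_one_mul]

/-- **(SF.5) HEAD — THE COEFFICIENT OF THE SIGNED TRANSPORT AT `ℓ′_k` IS THE SIGNED NORM-FIBRE SUM**: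
`(Σ_{μ ∈ supp P} x^{ℓ′_{μ₀−μ₂}} · (−1)^{μ₁} P_μ)_{ℓ′_k} = Σ_{μ ∈ supp P, μ₀−μ₂ = k} (−1)^{μ₁} P_μ` — with (SF.1) and ★ B3 `laurentEvalAt_eq_laurentEvalAt_line_two` + ★ `eq_of_forall_laurentEvalAt_eq`
this turns any graph identity on the signed line `(z, −1, z⁻¹)` into the statement «`U(1,1)` Satake coefficient at `ℓ′_k` = signed norm-fibre sum», exactly as ★ TB3∕TE3 did on the unsigned
line. [cite: Rogawski1990, §4.10 p. 57, Prop. 4.10.2 pp. 58–59] [cite: CartierCorvallis1979, §IV (4.2)–(4.4), Cor. 4.2] -/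
theorem coeff_signedNormFibre (P : AddMonoidAlgebra ℂ (Fin 3 → ℤ)) (k : ℤ) :
    (∑ μ ∈ P.coeff.support,
        AddMonoidAlgebra.single (fun i : Fin 2 => (μ 0 - μ 2) * (1 - 2 * ((i : ℕ) : ℤ))) (((((μ 1).negOnePow : ℤˣ) : ℤ) : ℂ) * P.coeff μ)).coeff
        (fun i : Fin 2 => k * (1 - 2 * ((i : ℕ) : ℤ))) =
      ∑ μ ∈ P.coeff.support with μ 0 - μ 2 = k, (((μ 1).negOnePow : ℤˣ) : ℤ) * P.coeff μ := by
  classical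
  rw [AddMonoidAlgebra.coeff_sum, Finsupp.finsetSum_apply, Finset.sum_filter]
  refine Finset.sum_congr rfl fun μ _ => ?_
  rw [AddMonoidAlgebra.coeff_single, Finsupp.single_apply]
  by_cases hk : μ 0 - μ 2 = k
  · rw [if_pos (by rw [hk]), if_pos hk]
  · rw [if_neg hk, if_neg]
    intro h
    apply hk
    have h0 := congrFun h 0
    simpa using h0

end Fibre

end Summit.HodgeConjecture.HodgeConjecture.R90.S6

end
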